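import Literature.NumberTheory.DiophantineGeometry.TateAlgorithmRingEquivProofs
import HarnessLib

/-!
# X11b at `p = 3` (team N8/O2), cross-cell service (o5o6 TARGETS (G4-6)(i)): Tate's algorithm is
# equivariant under UNRAMIFIED local homomorphisms of discrete valuation rings —
# part 1/4: transport of valuations, reduced coefficients and root counts along `ψ : R₁ →+* R₂`
# with `ψ π₁ = w π₂`

HONEST FRAMING (cell `b2b-bsdres`, run/shared/lean/b2b/bsd-rank1-residual/, verbatim in every
file): the goal of the cell is to DELETE the COMBINATION-SHAPED residual classes of the
Birch–Swinnerton-Dyer formula for ALL analytic-rank `≤ 1` elliptic curves over `ℚ` — "full BSD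
formula for every rank `≤ 1` curve in class `C`" assembled STRICTLY from published theorems — so
that the rank-`≤ 1` remainder becomes exactly the CONSTRUCTION-SHAPED classes, which are TYPED
(missing-input `Prop`s), NOT attempted. This is not "finishing BSD". Team N8/O2 = `x11b3`, seat
`b2b-bsdres-x11b3-p4` (lead GEN 7 R8-4 (b): "menu (2) KODAIRA-SYMBOL TRANSPORT along unramified
injective local homs of DVRs = GO-WHEN-FREE as a cross-cell service to o5o6 (G4-6)(i); Kodaira
TYPE only — `c_v` is NOT invariant"). THEOREMS ONLY: no definition, no named fact, no `sorry`;
nothing is booked; no mark / label / count moves.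

## What

The tree's `Literature/NumberTheory/DiophantineGeometry/TateAlgorithmRingEquivProofs.lean` proves
that the literal Tate algorithm `WeierstrassCurve.kodairaSymbolOfMinimal` is equivariant under a
ring ISOMORPHISM `ψ : R₁ ≃+* R₂` of discrete valuation rings with perfect residue fields. Its
proof never uses surjectivity: it needs only (i) `ψ π₁ = w π₂` for a unit `w` (i.e. the
extension is UNRAMIFIED, `e = 1`), (ii) the transport of `ord` / divisibility by powers of the
uniformiser, and (iii) a residue-field EMBEDDING through which the auxiliary polynomials keep
their number of distinct roots in an algebraic closure. This series (parts 1–4,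
`KodairaTransport{Basic,Coupling,Main,Fraction}`) re-runs the tree's argument for an arbitrary
LOCAL homomorphism `ψ : R₁ →+* R₂` (`[IsLocalHom ψ]`) with `ψ π₁ = w π₂` — e.g. the inclusion
`R₀ → R` of the valuation rings of an unramified layer `L ⊇ F` (the S15 binder R5), or
`𝒪_{K_v} → 𝒪_{L_w}` for `w ∣ v` unramified. This part 1:

* `exists_units_map_uniformizer_of_irreducible`, `addVal_map_eq_of_unif` (`ord₂ (ψ x) = ord₁ x`),
  `pow_dvd_map_iff_of_unif`, `dvd_map_iff_of_unif`, `map_mem_maximalIdeal_pow_iff_of_unif`,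
  `map_mem_maximalIdeal_iff_of_unif`;
* `redCoeff_map_of_unif` (`(ψ a)_{·,j} = w̄ʲ · ψ̄ (a_{·,j})`);
* `distinctRootCount_cubicStep6_map_of_unif`, `distinctRootCount_quadratic₁_map_of_unif`,
  `distinctRootCount_quadratic₂_map_of_unif`, `distinctRootCount_quadraticStep8_map_of_unif`
  (the step-6 cubic and the quadratics of steps 7–9 of `ψW` have as many distinct roots in `k̄₂`
  as those of `W` have in `k̄₁`; the residue map `ψ̄ : k₁ → k₂` is an embedding of fields, tree
  `distinctRootCount_map_ringHom`).

References (locators only; no new fact): [cite: SilvermanATAEC1994, IV.9.4 (PDF pp. 344–346),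
Rem. IV.9.5] [cite: Tate1975, §§7–8] [cite: SilvermanAEC2009, Prop. VII.5.4 (a) (PDF p. 175)].

## Design

No definitions; every ψ-lemma takes `(ψ : R₁ →+* R₂) [IsLocalHom ψ]` and the unramifiedness
witness `hw : ψ (uniformizer R₁) = w * uniformizer R₂`. The general root-count lemmas
(`distinctRootCount_map_ringHom`, `distinctRootCount_eq_of_comp_C_mul`, `residue_units_ne_zero`)
and all rigidity / invariance lemmas are the tree's, imported. Axioms: `propext`,
`Classical.choice`, `Quot.sound`.
-/

open Polynomial IsLocalRing

namespace Summit.BirchSwinnertonDyer.Rank1Residual.X11b.Three.KodairaTransport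

open Literature.NumberTheory.DiophantineGeometry Literature.NumberTheory.DiophantineGeometry.TateAlgorithm
  WeierstrassCurve

/-! ### Transport of the basic quantities along an unramified `ψ : R₁ →+* R₂` -/

section Transport

variable {R₁ R₂ : Type*} [CommRing R₁] [IsDomain R₁] [IsDiscreteValuationRing R₁]
  [CommRing R₂] [IsDomain R₂] [IsDiscreteValuationRing R₂] (ψ : R₁ →+* R₂) [IsLocalHom ψ]
  {w : R₂ˣ}

omit [IsLocalHom ψ] in
/-- If `ψ` maps the uniformiser of `R₁` to an irreducible element of `R₂` (unramified), then
`ψ π₁ = w π₂` for a unit `w`. [folklore] -/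
theorem exists_units_map_uniformizer_of_irreducible (h : Irreducible (ψ (uniformizer R₁))) :
    ∃ w : R₂ˣ, ψ (uniformizer R₁) = ↑w * uniformizer R₂ := by
  obtain ⟨w, hw⟩ := IsDiscreteValuationRing.associated_of_irreducible R₂ irreducible_uniformizer h
  exact ⟨w, by rw [← hw, mul_comm]⟩

omit [IsLocalHom ψ] in
/-- **`e = 1`: `ord₂ (ψ x) = ord₁ x`** when `ψ π₁ = w π₂` (`x = u π₁ⁿ ⇒ ψ x = (ψ u · wⁿ) π₂ⁿ`).
[folklore] -/
theorem addVal_map_eq_of_unif (hw : ψ (uniformizer R₁) = ↑w * uniformizer R₂) (x : R₁) :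
    IsDiscreteValuationRing.addVal R₂ (ψ x) = IsDiscreteValuationRing.addVal R₁ x := by
  by_cases hx : x = 0
  · simp [hx]
  obtain ⟨n, u, rfl⟩ := IsDiscreteValuationRing.eq_unit_mul_pow_irreducible hx irreducible_uniformizer
  have hu : IsUnit (ψ (u : R₁) * (w : R₂) ^ n) := (u.isUnit.map ψ).mul (w.isUnit.pow n)
  rw [IsDiscreteValuationRing.addVal_def' u irreducible_uniformizer n, map_mul, map_pow, hw, mul_pow,
    ← mul_assoc, ← hu.unit_spec, IsDiscreteValuationRing.addVal_def' _ irreducible_uniformizer n]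

omit [IsLocalHom ψ] in
/-- `π₂ ^ n ∣ ψ x ↔ π₁ ^ n ∣ x`. [folklore] -/
theorem pow_dvd_map_iff_of_unif (hw : ψ (uniformizer R₁) = ↑w * uniformizer R₂) (x : R₁) (n : ℕ) :
    uniformizer R₂ ^ n ∣ ψ x ↔ uniformizer R₁ ^ n ∣ x := by
  rw [pow_dvd_iff_le_addVal, pow_dvd_iff_le_addVal, addVal_map_eq_of_unif ψ hw]

omit [IsLocalHom ψ] in
/-- `π₂ ∣ ψ x ↔ π₁ ∣ x`. [folklore] -/
theorem dvd_map_iff_of_unif (hw : ψ (uniformizer R₁) = ↑w * uniformizer R₂) (x : R₁) :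
    uniformizer R₂ ∣ ψ x ↔ uniformizer R₁ ∣ x := by
  simpa using pow_dvd_map_iff_of_unif ψ hw x 1

omit [IsLocalHom ψ] in
/-- `ψ x ∈ 𝔪₂ ^ n ↔ x ∈ 𝔪₁ ^ n`. [folklore] -/
theorem map_mem_maximalIdeal_pow_iff_of_unif (hw : ψ (uniformizer R₁) = ↑w * uniformizer R₂)
    (x : R₁) (n : ℕ) : ψ x ∈ maximalIdeal R₂ ^ n ↔ x ∈ maximalIdeal R₁ ^ n := by
  rw [mem_maximalIdeal_pow_iff_dvd, mem_maximalIdeal_pow_iff_dvd, pow_dvd_map_iff_of_unif ψ hw]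

omit [IsLocalHom ψ] in
/-- `ψ x ∈ 𝔪₂ ↔ x ∈ 𝔪₁`. [folklore] -/
theorem map_mem_maximalIdeal_iff_of_unif (hw : ψ (uniformizer R₁) = ↑w * uniformizer R₂) (x : R₁) :
    ψ x ∈ maximalIdeal R₂ ↔ x ∈ maximalIdeal R₁ := by
  rw [mem_maximalIdeal_iff_dvd, mem_maximalIdeal_iff_dvd, dvd_map_iff_of_unif ψ hw]

/-- Transport of `redCoeff` along an unramified local `ψ`: if `ψ π₁ = w π₂` then
`(ψ a)_{·,j} = w̄ ^ j · ψ̄ (a_{·,j})`. [folklore] -/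
theorem redCoeff_map_of_unif (hw : ψ (uniformizer R₁) = ↑w * uniformizer R₂) (a : R₁) (j : ℕ) :
    redCoeff (ψ a) j = residue R₂ ↑w ^ j * ResidueField.map ψ (redCoeff a j) := by
  by_cases h : uniformizer R₁ ^ j ∣ a
  · have h' : uniformizer R₂ ^ j ∣ ψ a := (pow_dvd_map_iff_of_unif ψ hw a j).mpr h
    have e₁ := divPow_spec h
    have e₂ := divPow_spec h'
    have key : divPow (ψ a) j = ↑w ^ j * ψ (divPow a j) := by
      apply mul_left_cancel₀ (pow_ne_zero j (irreducible_uniformizer (R := R₂)).ne_zero)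
      rw [← e₂]
      conv_lhs => rw [e₁, map_mul, map_pow, hw]
      ring
    rw [redCoeff, key, map_mul, map_pow, redCoeff]
    rfl
  · have h' : ¬ uniformizer R₂ ^ j ∣ ψ a := fun h' ↦ h ((pow_dvd_map_iff_of_unif ψ hw a j).mp h')
    classical
    simp [redCoeff, divPow, h, h']

end Transport

/-! ### Root counts of the auxiliary polynomials along `ψ` -/

section RootCount

variable {R₁ R₂ : Type*} [CommRing R₁] [IsDomain R₁] [IsDiscreteValuationRing R₁]
  [CommRing R₂] [IsDomain R₂] [IsDiscreteValuationRing R₂]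

variable (ψ : R₁ →+* R₂) [IsLocalHom ψ] {w : R₂ˣ}

/-- The step-6 cubic of `W.map ψ` (formed with the uniformiser `π₂` of `R₂`) has as many distinct
roots in `k̄₂` as the step-6 cubic of `W` (formed with `π₁`) has in `k̄₁`: with `ψ π₁ = w π₂`
its coefficients are `w̄ʲ ψ̄ (a_{i,j})`, so it is `w̄³ · (ψ̄ P)(T / w̄)`. [folklore] -/
theorem distinctRootCount_cubicStep6_map_of_unif (hw : ψ (uniformizer R₁) = ↑w * uniformizer R₂)
    (W : WeierstrassCurve R₁) :
    distinctRootCount (cubicStep6 (W.map ψ)) = distinctRootCount (cubicStep6 W) := by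
  set e := ResidueField.map ψ with he
  set c := residue R₂ (w : R₂) with hc
  have hc0 : c ≠ 0 := residue_units_ne_zero w
  rw [← distinctRootCount_map_ringHom e (cubicStep6 W)]
  refine distinctRootCount_eq_of_comp_C_mul hc0 (pow_ne_zero 3 hc0) ?_
  simp only [cubicStep6, WeierstrassCurve.map_a₂, WeierstrassCurve.map_a₄,
    WeierstrassCurve.map_a₆, redCoeff_map_of_unif ψ hw, Polynomial.map_add,
    Polynomial.map_mul, Polynomial.map_pow, map_X, map_C, add_comp, mul_comp, pow_comp, X_comp,
    C_comp, C_mul, C_pow]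
  rw [← hc, ← he]
  ring

/-- The first quadratic `Y² + a₃,ₘ₊₂ Y − a₆,₂ₘ₊₄` of round `m` of the `Iₙ*` sub-procedure (for
`m = 0` also the step-8 quadratic) of `W.map ψ` versus that of `W`: same number of distinct roots
(it is `w̄^{2m+4} · (ψ̄ Q)(T / w̄^{m+2})`). [folklore] -/
theorem distinctRootCount_quadratic₁_map_of_unif (hw : ψ (uniformizer R₁) = ↑w * uniformizer R₂)
    (W : WeierstrassCurve R₁) (m : ℕ) :
    distinctRootCount (X ^ 2 + C (redCoeff (W.map ψ).a₃ (m + 2)) * X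
        - C (redCoeff (W.map ψ).a₆ (2 * m + 4))) =
      distinctRootCount
        (X ^ 2 + C (redCoeff W.a₃ (m + 2)) * X - C (redCoeff W.a₆ (2 * m + 4))) := by
  set e := ResidueField.map ψ with he
  set c := residue R₂ (w : R₂) with hc
  have hc0 : c ≠ 0 := residue_units_ne_zero w
  rw [← distinctRootCount_map_ringHom e (X ^ 2 + C (redCoeff W.a₃ (m + 2)) * X
    - C (redCoeff W.a₆ (2 * m + 4)))]
  refine distinctRootCount_eq_of_comp_C_mul (pow_ne_zero (m + 2) hc0)
    (pow_ne_zero (2 * m + 4) hc0) ?_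
  simp only [WeierstrassCurve.map_a₃, WeierstrassCurve.map_a₆, redCoeff_map_of_unif ψ hw,
    Polynomial.map_add, Polynomial.map_sub, Polynomial.map_mul, Polynomial.map_pow, map_X, map_C,
    add_comp, sub_comp, mul_comp, pow_comp, X_comp, C_comp, C_mul, C_pow]
  rw [← hc, ← he]
  ring

/-- The second quadratic `a₂,₁ X² + a₄,ₘ₊₃ X + a₆,₂ₘ₊₅` of round `m` of the `Iₙ*` sub-procedure of
`W.map ψ` versus that of `W`: same number of distinct roots
(it is `w̄^{2m+5} · (ψ̄ Q)(T / w̄^{m+2})`). [folklore] -/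
theorem distinctRootCount_quadratic₂_map_of_unif (hw : ψ (uniformizer R₁) = ↑w * uniformizer R₂)
    (W : WeierstrassCurve R₁) (m : ℕ) :
    distinctRootCount (C (redCoeff (W.map ψ).a₂ 1) * X ^ 2
        + C (redCoeff (W.map ψ).a₄ (m + 3)) * X
        + C (redCoeff (W.map ψ).a₆ (2 * m + 5))) =
      distinctRootCount (C (redCoeff W.a₂ 1) * X ^ 2 + C (redCoeff W.a₄ (m + 3)) * X
        + C (redCoeff W.a₆ (2 * m + 5))) := by
  set e := ResidueField.map ψ with he
  set c := residue R₂ (w : R₂) with hc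
  have hc0 : c ≠ 0 := residue_units_ne_zero w
  rw [← distinctRootCount_map_ringHom e (C (redCoeff W.a₂ 1) * X ^ 2
    + C (redCoeff W.a₄ (m + 3)) * X + C (redCoeff W.a₆ (2 * m + 5)))]
  refine distinctRootCount_eq_of_comp_C_mul (pow_ne_zero (m + 2) hc0)
    (pow_ne_zero (2 * m + 5) hc0) ?_
  simp only [WeierstrassCurve.map_a₂, WeierstrassCurve.map_a₄, WeierstrassCurve.map_a₆,
    redCoeff_map_of_unif ψ hw, Polynomial.map_add, Polynomial.map_mul,
    Polynomial.map_pow, map_X, map_C, add_comp, mul_comp, pow_comp, X_comp, C_comp, C_mul, C_pow]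
  rw [← hc, ← he]
  ring

/-- The step-8 quadratic of `W.map ψ` versus that of `W` (case `m = 0` of
`distinctRootCount_quadratic₁_map_of_unif`). [folklore] -/
theorem distinctRootCount_quadraticStep8_map_of_unif (hw : ψ (uniformizer R₁) = ↑w * uniformizer R₂)
    (W : WeierstrassCurve R₁) :
    distinctRootCount (quadraticStep8 (W.map ψ)) =
      distinctRootCount (quadraticStep8 W) := by
  have h := distinctRootCount_quadratic₁_map_of_unif ψ hw W 0
  simpa [quadraticStep8] using h

end RootCount

end Summit.BirchSwinnertonDyer.Rank1Residual.X11b.Three.KodairaTransport
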